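import Summits.AtomisticToContinuum.BoseEinsteinCondensation.Theorems.BECStronglyRayleighLatticeToPeriodicBridgeMuffinTinDeepWellOneBody
import HarnessLib

/-!
# Route `BECStronglyRayleigh`, crux `LatticeToPeriodicBridge` (stmt-AtomisticToContinuum-9674),
# line `muffin-tin-reward-supermodularity` — S2' decomposition, file 3/5: the free profile's readout and the
# hard-core basis functions

Third file of the worker decomposition of `Sig.stub_deepWellCondensateLimit` (see `…MuffinTinDeepWellProfiles.lean`).
* FREE readout: `DeepWell.freeProfile = blochMode^{⊗N}` vanishes off the cell, is continuous, is normalised on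
  `[0,L)^{3N}` (`lintegral_freeProfile_sq`, Fubini `integral_fintype_prod_volume_eq_prod`), and its constant-mode
  occupation is `n₀ = z_w N`, `z_w = deepShare w = ((8/π²)(1-w))³` (`condensateOccupation_freeProfile`: `a(φ₀)` acts on
  the first particle, `⟨φ₀, blochMode⟩² = z_w`);
* the hard-core basis functions `DeepWell.basisFun f = ∏ᵢ u_{f i}(xᵢ)`: pointwise orthogonality for `f ≠ g` (disjoint
  wells), `∫ P_f² = 1`, the orthogonal expansion `‖Σ_f a_f P_f‖² = Σ_f ‖a_f‖² P_f²`
  (`norm_sum_mul_basisFun_sq`), and the reduction `∫‖hardCoreProfile ψ‖² = (N!)⁻¹ Σ_f ‖ψ(1_{im f})‖²`.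
Registered sub-goal: `deepWellFreeReadout_constantModeIntegral` (`∫_cell conj(φ₀)·G = L^{-3/2} ∫_cell G`, global names).
-/

noncomputable section

namespace Summit.AtomisticToContinuum.BoseEinsteinCondensation.Cruxes.LatticeToPeriodicBridge.MuffinTinRewardSupermodularity

open MeasureTheory Filter Set
open scoped ENNReal NNReal BigOperators Topology ComplexConjugate
open Literature.MathematicalPhysics.QuantumManyBody.BoseGas
open Literature.MathematicalPhysics.QuantumLattice
open Literature.Probability.LatticeModels (TorusSite)
open Summit.AtomisticToContinuum.BoseEinsteinCondensation.Theses
open Summit.AtomisticToContinuum.BoseEinsteinCondensation.Theses.BECStronglyRayleigh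
open Summit.AtomisticToContinuum.BoseEinsteinCondensation.Theorems

namespace DeepWell

variable {M : ℕ} [NeZero M] {L w : ℝ} {N : ℕ}

/-! ## The free profile -/

/-- Readout computation helper. [folklore] -/
theorem freeProfile_eq_zero (hL : 0 < L) (hw0 : 0 < w) (hw1 : w < 1) {X : Config N}
    (hX : X ∉ cellN N L) : freeProfile M L w N X = 0 := by
  unfold freeProfile
  simp only [cellN, mem_setOf_eq, not_forall] at hX
  obtain ⟨i, hi⟩ := hX
  rw [Finset.prod_eq_zero (Finset.mem_univ i) (blochMode_eq_zero hL hw0 hw1 hi), Complex.ofReal_zero]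

/-- Readout computation helper. [folklore] -/
theorem continuous_freeProfile : Continuous (freeProfile M L w N) := by
  unfold freeProfile
  exact Complex.continuous_ofReal.comp
    (continuous_finsetProd _ fun i _ => continuous_blochMode.comp (continuous_apply i))

/-- Readout computation helper. [folklore] -/
theorem norm_freeProfile_sq (X : Config N) :
    ‖freeProfile M L w N X‖ ^ 2 = ∏ i, blochMode M L w (X i) ^ 2 := by
  rw [freeProfile, Complex.norm_real, Real.norm_eq_abs, sq_abs, Finset.prod_pow]

/-- Readout computation helper. [folklore] -/
theorem integral_norm_freeProfile_sq (hL : 0 < L) (hw0 : 0 < w) (hw1 : w < 1) :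
    ∫ X, ‖freeProfile M L w N X‖ ^ 2 = 1 := by
  simp_rw [norm_freeProfile_sq]
  rw [integral_fintype_prod_volume_eq_prod (𝕜 := ℝ) (fun _ : Fin N => fun y => blochMode M L w y ^ 2)]
  simp [integral_blochMode_sq hL hw0 hw1]

/-- Readout computation helper. [folklore] -/
theorem lintegral_freeProfile_sq (hL : 0 < L) (hw0 : 0 < w) (hw1 : w < 1) :
    ∫⁻ X in cellN N L, (‖freeProfile M L w N X‖₊ : ℝ≥0∞) ^ 2 = 1 := by
  rw [lintegral_cellN_nnnorm_sq_eq_ofReal L continuous_freeProfile,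
    setIntegral_eq_integral_of_forall_compl_eq_zero fun X hX => by
      rw [freeProfile_eq_zero hL hw0 hw1 hX, norm_zero, zero_pow two_ne_zero],
    integral_norm_freeProfile_sq hL hw0 hw1, ENNReal.ofReal_one]

/-- Readout computation helper. [folklore] -/
theorem freeProfile_vecCons {n : ℕ} (x : Space) (Y : Config n) :
    freeProfile M L w (n + 1) (Matrix.vecCons x Y) = (blochMode M L w x : ℂ) * freeProfile M L w n Y := by
  simp [freeProfile, Fin.prod_univ_succ]

/-- Readout computation helper. [folklore] -/
theorem setIntegral_cell_conj_constantMode_mul (L : ℝ) (G : Space → ℂ) :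
    ∫ x in cell L, conj (constantMode L x) * G x = ((Real.sqrt (L ^ 3))⁻¹ : ℂ) * ∫ x in cell L, G x := by
  rw [← integral_const_mul]
  refine setIntegral_congr_fun (measurableSet_cell L) fun x hx => ?_
  simp only [constantMode, Set.indicator_of_mem hx, map_inv₀, Complex.conj_ofReal]

/-- Readout computation helper. [folklore] -/
theorem modeAn_freeProfile (hL : 0 < L) (hw0 : 0 < w) (hw1 : w < 1) {n : ℕ} (Y : Config n) :
    modeAn L (constantMode L) (freeProfile M L w (n + 1)) Y =
      (((Real.sqrt (n + 1) * ((Real.sqrt (L ^ 3))⁻¹ * ∫ y, blochMode M L w y) : ℝ)) : ℂ) *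
        freeProfile M L w n Y := by
  unfold modeAn
  simp_rw [freeProfile_vecCons]
  have h1 : (fun x => conj (constantMode L x) * ((blochMode M L w x : ℂ) * freeProfile M L w n Y)) =
      fun x => (conj (constantMode L x) * (blochMode M L w x : ℂ)) * freeProfile M L w n Y := by
    funext x; ring
  rw [h1, integral_mul_const, setIntegral_cell_conj_constantMode_mul,
    setIntegral_eq_integral_of_forall_compl_eq_zero fun x hx => by
      rw [blochMode_eq_zero hL hw0 hw1 hx, Complex.ofReal_zero],
    integral_complex_ofReal]
  push_cast
  ring

/-- Readout computation helper. [folklore] -/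
theorem condensateOccupation_freeProfile (hL : 0 < L) (hw0 : 0 < w) (hw1 : w < 1) (n : ℕ) :
    condensateOccupation (n + 1) L (freeProfile M L w (n + 1)) = ENNReal.ofReal (deepShare w * (n + 1)) := by
  have hM : (0 : ℝ) < M := by exact_mod_cast Nat.pos_of_ne_zero (NeZero.ne M)
  rw [condensateOccupation_eq_lintegral_modeAn_constantMode]
  simp_rw [modeAn_freeProfile hL hw0 hw1, coe_nnnorm_mul_sq]
  rw [lintegral_const_mul' _ _ (ENNReal.pow_ne_top ENNReal.coe_ne_top), lintegral_freeProfile_sq hL hw0 hw1,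
    mul_one, coe_nnnorm_sq_eq_ofReal, Complex.norm_real, Real.norm_eq_abs, sq_abs, integral_blochMode hL hw0 hw1]
  congr 1
  set ℓ : ℝ := (1 - w) * (L / M) with hℓdef
  have hℓ : 0 < ℓ := mul_pos (by linarith) (div_pos hL hM)
  have hA : Real.sqrt (2 / ℓ) ^ 2 = 2 / ℓ := Real.sq_sqrt (by positivity)
  have hn : Real.sqrt (n + 1) ^ 2 = n + 1 := Real.sq_sqrt (by positivity)
  have hL3 : Real.sqrt (L ^ 3) ^ 2 = L ^ 3 := Real.sq_sqrt (by positivity)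
  have hM3 : Real.sqrt ((M : ℝ) ^ 3) ^ 2 = (M : ℝ) ^ 3 := Real.sq_sqrt (by positivity)
  calc (Real.sqrt (n + 1) * ((Real.sqrt (L ^ 3))⁻¹ * ((Real.sqrt ((M : ℝ) ^ 3))⁻¹ *
          (M * (Real.sqrt (2 / ℓ) * (2 * ℓ / Real.pi))) ^ 3))) ^ 2
      = Real.sqrt (n + 1) ^ 2 * (Real.sqrt (L ^ 3) ^ 2)⁻¹ * (Real.sqrt ((M : ℝ) ^ 3) ^ 2)⁻¹ *
          (M : ℝ) ^ 6 * (Real.sqrt (2 / ℓ) ^ 2) ^ 3 * (2 * ℓ / Real.pi) ^ 6 := by ring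
    _ = (n + 1) * (L ^ 3)⁻¹ * ((M : ℝ) ^ 3)⁻¹ * (M : ℝ) ^ 6 * (2 / ℓ) ^ 3 * (2 * ℓ / Real.pi) ^ 6 := by
        rw [hA, hn, hL3, hM3]
    _ = deepShare w * (n + 1) := by
        unfold deepShare
        rw [hℓdef]
        field_simp
        ring

/-! ## Hard-core basis functions -/

/-- Readout computation helper. [folklore] -/
theorem basisFun_mul_eq_zero (hL : 0 < L) (hw0 : 0 < w) (hw1 : w < 1) {f g : Fin N → TorusSite 3 M}
    (hfg : f ≠ g) (X : Config N) : basisFun M L w f X * basisFun M L w g X = 0 := by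
  obtain ⟨i, hi⟩ := Function.ne_iff.mp hfg
  unfold basisFun
  rw [← Finset.prod_mul_distrib]
  exact Finset.prod_eq_zero (Finset.mem_univ i) (wellMode_mul_eq_zero hL hw0 hw1 hi (X i))

/-- Readout computation helper. [folklore] -/
theorem basisFun_eq_zero (hL : 0 < L) (hw0 : 0 < w) (hw1 : w < 1) (f : Fin N → TorusSite 3 M)
    {X : Config N} (hX : X ∉ cellN N L) : basisFun M L w f X = 0 := by
  unfold basisFun
  simp only [cellN, mem_setOf_eq, not_forall] at hX
  obtain ⟨i, hi⟩ := hX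
  exact Finset.prod_eq_zero (Finset.mem_univ i) (wellMode_eq_zero hL hw0 hw1 (f i) hi)

omit [NeZero M] in
/-- Readout computation helper. [folklore] -/
theorem continuous_basisFun (f : Fin N → TorusSite 3 M) : Continuous (basisFun M L w f) := by
  unfold basisFun
  exact continuous_finsetProd _ fun i _ => (continuous_wellMode (f i)).comp (continuous_apply i)

/-- Readout computation helper. [folklore] -/
theorem integral_basisFun_sq (hL : 0 < L) (hw0 : 0 < w) (hw1 : w < 1) (f : Fin N → TorusSite 3 M) :
    ∫ X, basisFun M L w f X ^ 2 = 1 := by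
  unfold basisFun
  simp_rw [← Finset.prod_pow]
  rw [integral_fintype_prod_volume_eq_prod (𝕜 := ℝ) (fun i : Fin N => fun y => wellMode M L w (f i) y ^ 2)]
  simp [integral_wellMode_sq hL hw0 hw1]

/-- Readout computation helper. [folklore] -/
theorem integrable_basisFun_sq (hL : 0 < L) (hw0 : 0 < w) (hw1 : w < 1) (f : Fin N → TorusSite 3 M) :
    Integrable (fun X => basisFun M L w f X ^ 2) :=
  (integrableOn_cellN (f := fun X => basisFun M L w f X ^ 2) ((continuous_basisFun f).pow 2)
    L).integrable_of_forall_notMem_eq_zero fun X hX => by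
      change basisFun M L w f X ^ 2 = 0
      rw [basisFun_eq_zero hL hw0 hw1 f hX]; simp

/-- Orthogonal expansion: `‖Σ_f a_f P_f(X)‖² = Σ_f ‖a_f‖² P_f(X)²` pointwise. [folklore] -/
theorem norm_sum_mul_basisFun_sq (hL : 0 < L) (hw0 : 0 < w) (hw1 : w < 1)
    (a : (Fin N → TorusSite 3 M) → ℂ) (X : Config N) :
    ‖∑ f, a f * (basisFun M L w f X : ℂ)‖ ^ 2 = ∑ f, ‖a f‖ ^ 2 * basisFun M L w f X ^ 2 := by
  have key : (∑ f, a f * (basisFun M L w f X : ℂ)) * conj (∑ f, a f * (basisFun M L w f X : ℂ)) =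
      ((∑ f, ‖a f‖ ^ 2 * basisFun M L w f X ^ 2 : ℝ) : ℂ) := by
    rw [map_sum, Finset.sum_mul_sum]
    push_cast
    refine Finset.sum_congr rfl fun f _ => ?_
    rw [Finset.sum_eq_single f]
    · rw [map_mul, Complex.conj_ofReal, mul_mul_mul_comm, Complex.mul_conj, Complex.normSq_eq_norm_sq]
      push_cast
      ring
    · intro g _ hgf
      rw [map_mul, Complex.conj_ofReal, mul_mul_mul_comm, ← Complex.ofReal_mul, mul_comm (basisFun M L w f X),
        basisFun_mul_eq_zero hL hw0 hw1 hgf X]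
      simp
    · simp
  rw [Complex.mul_conj, Complex.normSq_eq_norm_sq] at key
  exact_mod_cast key

/-! ## The hard-core profile: vanishing, continuity, norm reduction -/

variable {ψ : TensorIndex (TorusSite 3 M) 2 → ℂ}

/-- Readout computation helper. [folklore] -/
theorem hardCoreProfile_eq_zero (hL : 0 < L) (hw0 : 0 < w) (hw1 : w < 1) {X : Config N}
    (hX : X ∉ cellN N L) : hardCoreProfile M L w N ψ X = 0 := by
  unfold hardCoreProfile
  rw [Finset.sum_eq_zero fun f _ => by rw [basisFun_eq_zero hL hw0 hw1 f hX]; simp, mul_zero]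

/-- Readout computation helper. [folklore] -/
theorem continuous_hardCoreProfile : Continuous (hardCoreProfile M L w N ψ) := by
  unfold hardCoreProfile
  refine continuous_const.mul (continuous_finsetSum _ fun f _ => continuous_const.mul ?_)
  exact Complex.continuous_ofReal.comp (continuous_basisFun f)

/-- Readout computation helper. [folklore] -/
theorem norm_hardCoreProfile_sq (hL : 0 < L) (hw0 : 0 < w) (hw1 : w < 1) (X : Config N) :
    ‖hardCoreProfile M L w N ψ X‖ ^ 2 = ((N.factorial : ℝ))⁻¹ *
      ∑ f : Fin N → TorusSite 3 M, ‖ψ (occInd (Finset.univ.image f))‖ ^ 2 * basisFun M L w f X ^ 2 := by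
  rw [hardCoreProfile, norm_mul, mul_pow, norm_sum_mul_basisFun_sq hL hw0 hw1]
  congr 1
  rw [norm_inv, Complex.norm_real, Real.norm_eq_abs, abs_of_nonneg (Real.sqrt_nonneg _), inv_pow,
    Real.sq_sqrt (by positivity)]

/-- Readout computation helper. [folklore] -/
theorem integral_norm_hardCoreProfile_sq (hL : 0 < L) (hw0 : 0 < w) (hw1 : w < 1) :
    ∫ X, ‖hardCoreProfile M L w N ψ X‖ ^ 2 =
      ((N.factorial : ℝ))⁻¹ * ∑ f : Fin N → TorusSite 3 M, ‖ψ (occInd (Finset.univ.image f))‖ ^ 2 := by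
  simp_rw [norm_hardCoreProfile_sq hL hw0 hw1]
  rw [integral_const_mul, integral_finsetSum _ fun f _ => (integrable_basisFun_sq hL hw0 hw1 f).const_mul _]
  congr 1
  refine Finset.sum_congr rfl fun f _ => ?_
  rw [integral_const_mul, integral_basisFun_sq hL hw0 hw1, mul_one]

end DeepWell

/-! ## The registered sub-goal of this file -/

/-- **Registered sub-goal `deepWellFreeReadout_constantModeIntegral`** (S2' decomposition, file 3/5): on the cell the
constant mode is the constant `L^{-3/2}`, so `∫_cell conj(φ₀) G = L^{-3/2} ∫_cell G`
(`DeepWell.setIntegral_cell_conj_constantMode_mul`, global names). [folklore] -/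
theorem deepWellFreeReadout_constantModeIntegral :
    ∀ (L : ℝ) (G : EuclideanSpace ℝ (Fin 3) → ℂ), MeasureTheory.integral (MeasureTheory.Measure.restrict MeasureTheory.volume (Literature.MathematicalPhysics.QuantumManyBody.BoseGas.cell L)) (fun x => (starRingEnd ℂ) (Literature.MathematicalPhysics.QuantumManyBody.BoseGas.constantMode L x) * G x) = ((Real.sqrt (L ^ 3))⁻¹ : ℂ) * MeasureTheory.integral (MeasureTheory.Measure.restrict MeasureTheory.volume (Literature.MathematicalPhysics.QuantumManyBody.BoseGas.cell L)) (fun x => G x) :=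
  fun L G => DeepWell.setIntegral_cell_conj_constantMode_mul L G

end Summit.AtomisticToContinuum.BoseEinsteinCondensation.Cruxes.LatticeToPeriodicBridge.MuffinTinRewardSupermodularity

end
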